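import Mathlib.Data.Fin.Tuple.NatAntidiagonal
import Mathlib.Order.PiLex
import Mathlib.Algebra.Order.Group.PiLex
import Mathlib.Algebra.BigOperators.Fin
import Mathlib.Algebra.Order.BigOperators.Group.Finset
import Mathlib.Algebra.Group.Pi.Lemmas
import Mathlib.Algebra.Order.Sub.Basic
import HarnessLib

/-!
# Macaulay's theorem on lex segments, I: lex segments, Borel sets, Miller–Sturmfels' Lemma 2.25

The combinatorial core of Macaulay's theorem (1927) on the growth of Hilbert functions, in the
upper-shadow form for sets of monomials, following Miller–Sturmfels, *Combinatorial Commutative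
Algebra* (GTM 227), §2.4. For a *Borel* (strongly stable) set `B` of degree-`d` monomials and a
*lex segment* `L` (an upper set of `Mon_d` for the lexicographic order) with `|L| ≤ |B|`:
`μ_{≤ i}(L) ≤ μ_{≤ i}(B)` for every `i` (**Lemma 2.25**, `mu_le_mu_of_isLexSeg_of_isBorel`), where
`μ_{≤ i}(W)` counts the members of `W` involving only `x_0, …, x_i`. Since `|∇W| = Σ_i μ_{≤ i}(W)`
for Borel `W` (identity **(2.3)**, `card_shadow_eq_sum_mu`; `∇W = {x_i w}` the upper shadow), the
lex segment has the smaller shadow (`card_shadow_le_of_isLexSeg_of_isBorel`, the inequality in the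
proof of Prop. 2.21 / Thm. 2.22).

Conventions. Monomials in `n` variables are exponent vectors `Fin n → ℕ`; `Mon n d` is
`Finset.Nat.antidiagonalTuple n d`; the order is `Pi.Lex` through `toLex` (`x_0 > x_1 > ⋯`, the
smallest index is the most significant); the slicing `B = ⋃_j x_n^j · B[j]` of the proof of
Lemma 2.25 is by the exponent of the LAST variable (`snoc`/`Fin.init`, `slice`); Borel moves are
`b ↦ b · x_i / x_j` for `i < j`.

Continued in `MacaulayCompression.lean` (arbitrary families are reduced to Borel sets by a
combinatorial compression — this replaces Miller–Sturmfels' use of generic initial ideals, which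
needs characteristic `0`, and makes the whole argument field-free) and `MacaulayBoundProofs.lean`
(the dimension form; discharge of the named fact `MacaulayGrowthBound`). Deliberately NOT here:
Hilbert functions of graded algebras, Macaulay representations and pseudo-powers `a^{<d>}`, the
lower-shadow (order-ideal / multicomplex) form, Clements–Lindström, Gotzmann persistence.

## References

* [MillerSturmfels2005] E. Miller, B. Sturmfels, *Combinatorial Commutative Algebra*, Graduate
  Texts in Mathematics 227, Springer (2005), §2.4: identity (2.3), Lemma 2.25, Prop. 2.21,
  Thm. 2.22 (Macaulay).
-/

namespace Literature.RingTheory.MvPolynomial.Macaulay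

open Finset

variable {n : ℕ}

/-- The monomials of degree `d` in `n` variables, as exponent vectors `Fin n → ℕ`. [folklore] -/
abbrev Mon (n d : ℕ) : Finset (Fin n → ℕ) := Finset.Nat.antidiagonalTuple n d

/-- Membership in `Mon n d`: the exponents sum to `d`. [folklore] -/
theorem mem_Mon {d : ℕ} {u : Fin n → ℕ} : u ∈ Mon n d ↔ ∑ i, u i = d :=
  Finset.Nat.mem_antidiagonalTuple

/-- The unit exponent vector of the variable `i`. [folklore] -/
abbrev e (i : Fin n) : Fin n → ℕ := Pi.single i 1

/-- The unit vector `e i` has degree `1`. [folklore] -/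
theorem sum_e (i : Fin n) : ∑ j, e i j = 1 := by
  simp [e]

/-- Multiplying by `x_i` raises the degree by one. [folklore] -/
theorem sum_add_e (a : Fin n → ℕ) (i : Fin n) : ∑ j, (a + e i) j = (∑ j, a j) + 1 := by
  simp [Finset.sum_add_distrib]

/-- `x_i · a ∈ Mon_{d+1}` for `a ∈ Mon_d`. [folklore] -/
theorem add_e_mem_Mon {d : ℕ} {a : Fin n → ℕ} (ha : a ∈ Mon n d) (i : Fin n) :
    a + e i ∈ Mon n (d + 1) := by
  rw [mem_Mon] at ha ⊢
  rw [sum_add_e, ha]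

/-- The upper shadow `{x_i · a : a ∈ A, i}` of a family of monomials. [folklore] -/
def shadow (A : Finset (Fin n → ℕ)) : Finset (Fin n → ℕ) :=
  A.biUnion fun a => univ.image fun i => a + e i

/-- Membership in the upper shadow. [folklore] -/
theorem mem_shadow {A : Finset (Fin n → ℕ)} {b : Fin n → ℕ} :
    b ∈ shadow A ↔ ∃ a ∈ A, ∃ i, b = a + e i := by
  simp only [shadow, mem_biUnion, mem_image, mem_univ, true_and]
  constructor
  · rintro ⟨a, ha, i, rfl⟩
    exact ⟨a, ha, i, rfl⟩
  · rintro ⟨a, ha, i, rfl⟩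
    exact ⟨a, ha, i, rfl⟩

/-- `x_i · a` lies in the shadow of any family containing `a`. [folklore] -/
theorem add_e_mem_shadow {A : Finset (Fin n → ℕ)} {a : Fin n → ℕ} (ha : a ∈ A) (i : Fin n) :
    a + e i ∈ shadow A :=
  mem_shadow.2 ⟨a, ha, i, rfl⟩

/-- The shadow of a family of degree-`d` monomials consists of degree-`(d+1)` monomials. [folklore] -/
theorem shadow_subset_Mon {A : Finset (Fin n → ℕ)} {d : ℕ} (hA : A ⊆ Mon n d) :
    shadow A ⊆ Mon n (d + 1) := by
  intro b hb
  obtain ⟨a, ha, i, rfl⟩ := mem_shadow.1 hb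
  exact add_e_mem_Mon (hA ha) i

/-- The upper shadow is monotone. [folklore] -/
theorem shadow_mono {A B : Finset (Fin n → ℕ)} (h : A ⊆ B) : shadow A ⊆ shadow B := by
  intro b hb
  obtain ⟨a, ha, i, rfl⟩ := mem_shadow.1 hb
  exact add_e_mem_shadow (h ha) i

/-! ### The lexicographic order (`x_0 > x_1 > ⋯`, via `toLex`) -/

/-- Unfolding the lexicographic order on exponent vectors (`x_0` most significant). [folklore] -/
theorem lex_lt_iff {a b : Fin n → ℕ} :
    toLex a < toLex b ↔ ∃ i, (∀ j < i, a j = b j) ∧ a i < b i := Iff.rfl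

/-- A lex segment of degree `d`: an upper set of `Mon n d` for the lexicographic order. [cite: MillerSturmfels2005, §2.4 (lex segment)] -/
def IsLexSeg (L : Finset (Fin n → ℕ)) (d : ℕ) : Prop :=
  L ⊆ Mon n d ∧ ∀ ⦃a⦄, a ∈ L → ∀ ⦃b⦄, b ∈ Mon n d → toLex a < toLex b → b ∈ L

/-- A Borel (strongly stable) set: closed under the moves `b ↦ b x_i / x_j` for `i < j`. [cite: MillerSturmfels2005, §2.4 (Borel set)] -/
def IsBorel (B : Finset (Fin n → ℕ)) : Prop :=
  ∀ ⦃b⦄, b ∈ B → ∀ ⦃i j : Fin n⦄, i < j → 0 < b j → b - e j + e i ∈ B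

/-- `μ_{≤ i}(B)`: the members of `B` involving only the variables `x_0, …, x_i`. [cite: MillerSturmfels2005, §2.4 (μ_{≤i})] -/
def mu (B : Finset (Fin n → ℕ)) (i : Fin n) : ℕ := (B.filter fun b => ∀ j, i < j → b j = 0).card

/-! ### Lex segments: nesting and existence -/

/-- Two lex segments of the same degree are nested according to their cardinalities. [folklore] -/
theorem IsLexSeg.subset_of_card_le {L L' : Finset (Fin n → ℕ)} {d : ℕ} (hL : IsLexSeg L d)
    (hL' : IsLexSeg L' d) (h : L.card ≤ L'.card) : L ⊆ L' := by
  by_contra hnot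
  obtain ⟨a, haL, haL'⟩ := not_subset.1 hnot
  have hsub : L' ⊆ L := by
    intro b hb
    rcases lt_trichotomy (toLex b) (toLex a) with hlt | heq | hgt
    · exact absurd (hL'.2 hb (hL.1 haL) hlt) haL'
    · exact absurd (toLex.injective heq ▸ hb) haL'
    · exact hL.2 haL (hL'.1 hb) hgt
  have : L'.card < L.card := card_lt_card ⟨hsub, fun h' => haL' (h' haL)⟩
  omega

/-- Lex segments of the same degree and cardinality coincide. [folklore] -/
theorem IsLexSeg.eq_of_card_eq {L L' : Finset (Fin n → ℕ)} {d : ℕ} (hL : IsLexSeg L d)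
    (hL' : IsLexSeg L' d) (h : L.card = L'.card) : L = L' :=
  eq_of_subset_of_card_le (hL.subset_of_card_le hL' h.le) h.ge

/-- There is a lex segment of every cardinality `c ≤ |Mon n d|` (the `c` lex-largest monomials). [folklore] -/
theorem exists_isLexSeg_card_eq (d c : ℕ) (hc : c ≤ (Mon n d).card) :
    ∃ L : Finset (Fin n → ℕ), IsLexSeg L d ∧ L.card = c := by
  induction c with
  | zero => exact ⟨∅, ⟨empty_subset _, fun a ha => absurd ha (notMem_empty a)⟩, rfl⟩
  | succ c ih =>
    obtain ⟨L, hL, hcard⟩ := ih (Nat.le_of_succ_le hc)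
    have hne : (Mon n d \ L).Nonempty := by
      rw [← card_pos, card_sdiff_of_subset hL.1]
      omega
    -- the lex-largest monomial not yet in `L`
    obtain ⟨b, hb, hmax⟩ := exists_max_image (Mon n d \ L) (fun x => toLex x) hne
    rw [mem_sdiff] at hb
    refine ⟨insert b L, ⟨insert_subset hb.1 hL.1, ?_⟩, by rw [card_insert_of_notMem hb.2, hcard]⟩
    intro a ha b' hb' hlt
    rw [mem_insert] at ha ⊢
    rcases ha with rfl | ha
    · right
      by_contra hb'L
      exact absurd (hmax b' (mem_sdiff.2 ⟨hb', hb'L⟩)) (not_le.2 hlt)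
    · exact Or.inr (hL.2 ha hb' hlt)

/-! ### Pointwise bookkeeping for the moves `b ↦ b - e j + e i` -/

/-- Coordinates of the unit vector. [folklore] -/
theorem e_apply (i j : Fin n) : e i j = if j = i then 1 else 0 := by
  simp [e, Pi.single_apply]

/-- `(x_i a) / x_i = a`. [folklore] -/
theorem add_e_sub_e (a : Fin n → ℕ) (i : Fin n) : a + e i - e i = a := by
  ext j; simp

/-- `x_l (v / x_l) = v` when `x_l ∣ v`. [folklore] -/
theorem sub_e_add_e {v : Fin n → ℕ} {l : Fin n} (h : 0 < v l) : v - e l + e l = v := by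
  ext j
  simp only [Pi.add_apply, Pi.sub_apply, e_apply]
  split_ifs with hj
  · subst hj; omega
  · simp

/-- `e l ≤ v` coordinatewise iff `x_l ∣ v`. [folklore] -/
theorem e_le_iff {v : Fin n → ℕ} {l : Fin n} : e l ≤ v ↔ 0 < v l := by
  constructor
  · intro h; have := h l; simp at this; omega
  · intro h j; simp only [e_apply]; split_ifs with hj
    · subst hj; omega
    · exact Nat.zero_le _

/-- Dividing by a variable lowers the degree by one. [folklore] -/
theorem sum_sub_e {v : Fin n → ℕ} {l : Fin n} (h : 0 < v l) :
    ∑ j, (v - e l) j = (∑ j, v j) - 1 := by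
  have : ∑ j, (v - e l) j = ∑ j, (v j - e l j) := by simp
  rw [this, sum_tsub_distrib _ (fun j _ => (e_le_iff.2 h) j), sum_e]

/-- `v / x_l ∈ Mon_d` for `v ∈ Mon_{d+1}` divisible by `x_l`. [folklore] -/
theorem sub_e_mem_Mon {d : ℕ} {v : Fin n → ℕ} (hv : v ∈ Mon n (d + 1)) {l : Fin n} (h : 0 < v l) :
    v - e l ∈ Mon n d := by
  rw [mem_Mon] at hv ⊢
  rw [sum_sub_e h, hv]; rfl

/-- A monomial of positive degree has a last (largest-index) variable. [folklore] -/
theorem exists_last_var {d : ℕ} {v : Fin n → ℕ} (hv : v ∈ Mon n (d + 1)) :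
    ∃ l, 0 < v l ∧ ∀ r, l < r → v r = 0 := by
  classical
  have hne : (univ.filter fun r => 0 < v r).Nonempty := by
    by_contra h
    rw [not_nonempty_iff_eq_empty, filter_eq_empty_iff] at h
    rw [mem_Mon] at hv
    have : ∑ i, v i = 0 := sum_eq_zero fun i _ => Nat.eq_zero_of_not_pos (h (mem_univ i))
    omega
  refine ⟨(univ.filter fun r => 0 < v r).max' hne, (mem_filter.1 (max'_mem _ hne)).2, fun r hr => ?_⟩
  by_contra h0
  exact absurd (le_max' _ r (mem_filter.2 ⟨mem_univ r, Nat.pos_of_ne_zero h0⟩)) (not_le.2 hr)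

/-! ### The shadow of a lex segment is a lex segment -/

/-- Key comparison: if `v < v'` in lex (same degree), `x_i ∣ v` and `l` is the last variable of `v'`,
then `v / x_i ≤ v' / x_l`.
[folklore] -/
theorem toLex_sub_le_sub_last {v v' : Fin n → ℕ} (hvv' : toLex v < toLex v') {i l : Fin n}
    (hi : 0 < v i) (hl : 0 < v' l) (hlmax : ∀ r, l < r → v' r = 0)
    (hdeg : ∑ j, v j = ∑ j, v' j) : toLex (v - e i) ≤ toLex (v' - e l) := by
  obtain ⟨p, hp, hvp⟩ := lex_lt_iff.1 hvv'
  -- `p ≤ l` since `v' p > 0`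
  have hpl : p ≤ l := by
    by_contra h
    have := hlmax p (not_le.1 h)
    omega
  -- pointwise facts
  have hle_lt : ∀ q, q < p → (v - e i) q ≤ (v' - e l) q ∨ l = p := by
    intro q hq
    rcases hpl.lt_or_eq with hpl' | hpl'
    · left
      have hql : q ≠ l := fun h => by subst h; exact absurd (hq.trans hpl') (lt_irrefl _)
      simp only [Pi.sub_apply, e_apply, if_neg hql, hp q hq]
      split_ifs <;> omega
    · exact Or.inr hpl'.symm
  by_contra hcon
  rw [not_le, lex_lt_iff] at hcon
  obtain ⟨q, hq, hlt⟩ := hcon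
  rcases hpl.lt_or_eq with hpl' | rfl
  · -- case `p < l`: `v - e i ≤ v' - e l` coordinatewise on indices `≤ p`, strictly at `p`
    have hcoord : ∀ r, r ≤ p → (v - e i) r ≤ (v' - e l) r := by
      intro r hr
      have hrl : r ≠ l := fun h => by subst h; exact absurd (hr.trans_lt hpl') (lt_irrefl _)
      simp only [Pi.sub_apply, e_apply, if_neg hrl]
      rcases hr.lt_or_eq with hr' | rfl
      · rw [hp r hr']; split_ifs <;> omega
      · split_ifs <;> omega
    rcases le_or_gt q p with hqp | hqp
    · exact absurd (hcoord q hqp) (not_le.2 hlt)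
    · have h1 := hq p hqp
      have h2 : (v - e i) p < (v' - e l) p := by
        have hpl'' : p ≠ l := hpl'.ne
        simp only [Pi.sub_apply, e_apply, if_neg hpl'']
        split_ifs <;> omega
      omega
  · -- case `p = l`: then `v' - e p ≤ v - e i` fails by a degree count
    -- coordinates `r < q` agree (hq); we show `v' - e p ≤ v - e i` pointwise with strictness at `q`,
    -- contradicting the equality of degrees, unless `q ≤ p` where a direct comparison works.
    rcases le_or_gt q p with hqp | hqp
    · -- direct comparison at `q ≤ p`
      rcases hqp.lt_or_eq with hqp' | rfl
      · have : (v - e i) q ≤ (v' - e p) q := by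
          have hqne : q ≠ p := hqp'.ne
          simp only [Pi.sub_apply, e_apply, if_neg hqne, hp q hqp']
          split_ifs <;> omega
        omega
      · have : (v - e i) q ≤ (v' - e q) q := by
          simp only [Pi.sub_apply, e_apply]
          split_ifs <;> omega
        omega
    · -- `q > p = l`: pointwise `v' - e p ≤ v - e i`, strict at `q`
      have hpt : ∀ r, (v' - e p) r ≤ (v - e i) r := by
        intro r
        rcases lt_or_ge r q with hrq | hrq
        · exact (hq r hrq).le
        · have hr0 : v' r = 0 := hlmax r (hqp.trans_le hrq)
          simp only [Pi.sub_apply, hr0, zero_tsub]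
          exact Nat.zero_le _
      have hsum : ∑ r, (v' - e p) r < ∑ r, (v - e i) r :=
        sum_lt_sum (fun r _ => hpt r) ⟨q, mem_univ q, hlt⟩
      rw [sum_sub_e hi, sum_sub_e hl] at hsum
      omega

/-- The upper shadow of a lex segment is a lex segment (Miller–Sturmfels §2.4, used in the proof of Lemma 2.25). [folklore] -/
theorem isLexSeg_shadow {L : Finset (Fin n → ℕ)} {d : ℕ} (hL : IsLexSeg L d) :
    IsLexSeg (shadow L) (d + 1) := by
  refine ⟨shadow_subset_Mon hL.1, fun v hv v' hv' hlt => ?_⟩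
  obtain ⟨u, hu, i, rfl⟩ := mem_shadow.1 hv
  obtain ⟨l, hl, hlmax⟩ := exists_last_var hv'
  have hdeg : ∑ j, (u + e i) j = ∑ j, v' j := by
    rw [(mem_Mon.1 (add_e_mem_Mon (hL.1 hu) i)), mem_Mon.1 hv']
  have hle := toLex_sub_le_sub_last hlt (i := i) (by simp) hl hlmax hdeg
  rw [add_e_sub_e] at hle
  have hu' : v' - e l ∈ L := by
    rcases hle.lt_or_eq with hlt' | heq
    · exact hL.2 hu (sub_e_mem_Mon hv' hl) hlt'
    · exact toLex.injective heq ▸ hu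
  exact mem_shadow.2 ⟨v' - e l, hu', l, (sub_e_add_e hl).symm⟩

/-- Lex segments are Borel. [cite: MillerSturmfels2005, §2.4] -/
theorem IsLexSeg.isBorel {L : Finset (Fin n → ℕ)} {d : ℕ} (hL : IsLexSeg L d) : IsBorel L := by
  intro b hb i j hij hbj
  have hbd : b ∈ Mon n d := hL.1 hb
  have hjle : b j ≤ ∑ k, b k := single_le_sum (f := b) (fun _ _ => Nat.zero_le _) (mem_univ j)
  have hd : d = d - 1 + 1 := by have := mem_Mon.1 hbd; omega
  rw [hd] at hbd
  have hmem : b - e j + e i ∈ Mon n d := by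
    have h := add_e_mem_Mon (sub_e_mem_Mon hbd hbj) i
    rwa [← hd] at h
  refine hL.2 hb hmem (lex_lt_iff.2 ⟨i, fun k hk => ?_, ?_⟩)
  · have hki : k ≠ i := hk.ne
    have hkj : k ≠ j := (hk.trans hij).ne
    simp [hki, hkj]
  · have hij' : i ≠ j := hij.ne
    simp [hij']

/-- `x_k a / x_i = (a / x_i) x_k` when `x_i ∣ a`, `k ≠ i`. [folklore] -/
theorem add_e_sub_e_comm {a : Fin n → ℕ} {i k : Fin n} (h : 0 < a i) (hki : k ≠ i) :
    a + e k - e i = a - e i + e k := by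
  ext r
  simp only [Pi.add_apply, Pi.sub_apply, e_apply]
  by_cases hri : r = i
  · subst hri; simp [hki.symm]
  · simp [hri]

/-! ### Appending the exponent of the last variable -/

/-- `snoc u j`: the exponent vector `u` in the first `n` variables, exponent `j` of the last one. [folklore] -/
def snoc (u : Fin n → ℕ) (j : ℕ) : Fin (n + 1) → ℕ := Fin.snoc (α := fun _ => ℕ) u j

/-- The first `n` coordinates of `snoc u j`. [folklore] -/
@[simp] theorem snoc_castSucc (u : Fin n → ℕ) (j : ℕ) (k : Fin n) : snoc u j k.castSucc = u k := by
  simp [snoc]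

/-- The last coordinate of `snoc u j`. [folklore] -/
@[simp] theorem snoc_last (u : Fin n → ℕ) (j : ℕ) : snoc u j (Fin.last n) = j := by
  simp [snoc]

/-- `init (snoc u j) = u`. [folklore] -/
@[simp] theorem init_snoc (u : Fin n → ℕ) (j : ℕ) : Fin.init (snoc u j) = u := by
  simp [snoc]

/-- Every vector is `snoc` of its initial part and its last coordinate. [folklore] -/
theorem snoc_init_self (b : Fin (n + 1) → ℕ) : snoc (Fin.init b) (b (Fin.last n)) = b := by
  simp [snoc]

/-- `snoc` is injective in both arguments. [folklore] -/
theorem snoc_inj {u u' : Fin n → ℕ} {j j' : ℕ} : snoc u j = snoc u' j' ↔ u = u' ∧ j = j' := by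
  constructor
  · intro h
    refine ⟨?_, ?_⟩
    · have := congrArg Fin.init h
      simpa using this
    · have := congrFun h (Fin.last n)
      simpa using this
  · rintro ⟨rfl, rfl⟩; rfl

/-- Degree of `snoc u j`. [folklore] -/
theorem sum_snoc (u : Fin n → ℕ) (j : ℕ) : ∑ i, snoc u j i = (∑ i, u i) + j := by
  rw [Fin.sum_univ_castSucc]; simp

/-- `snoc u j ∈ Mon_{d}` iff `|u| + j = d`. [folklore] -/
theorem snoc_mem_Mon {d : ℕ} {u : Fin n → ℕ} {j : ℕ} : snoc u j ∈ Mon (n + 1) d ↔ (∑ i, u i) + j = d := by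
  rw [mem_Mon, sum_snoc]

/-- Multiplying `snoc u j` by one of the first `n` variables. [folklore] -/
theorem snoc_add_e_castSucc (u : Fin n → ℕ) (j : ℕ) (k : Fin n) :
    snoc u j + e k.castSucc = snoc (u + e k) j := by
  ext r
  cases r using Fin.lastCases with
  | last => simp [(Fin.castSucc_lt_last k).ne']
  | cast r => simp [e_apply, Fin.castSucc_inj]

/-- Dividing `snoc u j` by one of the first `n` variables. [folklore] -/
theorem snoc_sub_e_castSucc (u : Fin n → ℕ) (j : ℕ) (k : Fin n) :
    snoc u j - e k.castSucc = snoc (u - e k) j := by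
  ext r
  cases r using Fin.lastCases with
  | last => simp [(Fin.castSucc_lt_last k).ne']
  | cast r => simp [e_apply, Fin.castSucc_inj]

/-- Dividing `snoc u (j+1)` by the last variable. [folklore] -/
theorem snoc_succ_sub_e_last (u : Fin n → ℕ) (j : ℕ) :
    snoc u (j + 1) - e (Fin.last n) = snoc u j := by
  ext r
  cases r using Fin.lastCases with
  | last => simp
  | cast r => simp [(Fin.castSucc_lt_last r).ne]

/-- Multiplying `snoc u j` by the last variable. [folklore] -/
theorem snoc_add_e_last (u : Fin n → ℕ) (j : ℕ) :
    snoc u j + e (Fin.last n) = snoc u (j + 1) := by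
  ext r
  cases r using Fin.lastCases with
  | last => simp
  | cast r => simp [(Fin.castSucc_lt_last r).ne]

/-- Lex comparison of appended vectors: the last variable is the least significant. [folklore] -/
theorem toLex_snoc_lt_snoc_iff {u v : Fin n → ℕ} {a b : ℕ} :
    toLex (snoc u a) < toLex (snoc v b) ↔ toLex u < toLex v ∨ (u = v ∧ a < b) := by
  rw [lex_lt_iff, lex_lt_iff]
  constructor
  · rintro ⟨i, hi, hlt⟩
    cases i using Fin.lastCases with
    | last =>
      right
      refine ⟨funext fun k => ?_, by simpa using hlt⟩
      simpa using hi k.castSucc (Fin.castSucc_lt_last k)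
    | cast i =>
      left
      refine ⟨i, fun k hk => ?_, by simpa using hlt⟩
      simpa using hi k.castSucc (Fin.castSucc_lt_castSucc_iff.2 hk)
  · rintro (⟨i, hi, hlt⟩ | ⟨rfl, hab⟩)
    · refine ⟨i.castSucc, fun k hk => ?_, by simpa using hlt⟩
      cases k using Fin.lastCases with
      | last => exact absurd hk (not_lt.2 (Fin.castSucc_lt_last i).le)
      | cast k => simpa using hi k (Fin.castSucc_lt_castSucc_iff.1 hk)
    · refine ⟨Fin.last n, fun k hk => ?_, by simpa using hab⟩
      obtain ⟨k', rfl⟩ := Fin.exists_castSucc_eq.2 hk.ne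
      simp

/-! ### Slices by the exponent of the last variable -/

/-- `slice B j = { u : snoc u j ∈ B }`, the `x_n^j`-slice of `B` (M–S: `B[j]`). [cite: MillerSturmfels2005, proof of Lemma 2.25 (B[i])] -/
def slice (B : Finset (Fin (n + 1) → ℕ)) (j : ℕ) : Finset (Fin n → ℕ) :=
  (B.filter fun b => b (Fin.last n) = j).image Fin.init

/-- Membership in a slice: `u ∈ B[j] ↔ snoc u j ∈ B`. [folklore] -/
theorem mem_slice {B : Finset (Fin (n + 1) → ℕ)} {j : ℕ} {u : Fin n → ℕ} :
    u ∈ slice B j ↔ snoc u j ∈ B := by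
  simp only [slice, mem_image, mem_filter]
  constructor
  · rintro ⟨b, ⟨hb, hbj⟩, rfl⟩
    have : snoc (Fin.init b) j = b := by rw [← hbj]; exact snoc_init_self b
    rwa [this]
  · intro h
    exact ⟨snoc u j, ⟨h, snoc_last u j⟩, init_snoc u j⟩

/-- Degree bookkeeping for members of a slice. [folklore] -/
theorem le_of_mem_slice {B : Finset (Fin (n + 1) → ℕ)} {d j : ℕ} (hB : B ⊆ Mon (n + 1) d)
    {u : Fin n → ℕ} (hu : u ∈ slice B j) : (∑ i, u i) + j = d :=
  snoc_mem_Mon.1 (hB (mem_slice.1 hu))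

/-- The `j`-th slice of a degree-`d` family has degree `d - j`. [folklore] -/
theorem slice_subset_Mon {B : Finset (Fin (n + 1) → ℕ)} {d : ℕ} (hB : B ⊆ Mon (n + 1) d) (j : ℕ) :
    slice B j ⊆ Mon n (d - j) := by
  intro u hu
  have := le_of_mem_slice hB hu
  rw [mem_Mon]; omega

/-- Slices beyond the degree are empty. [folklore] -/
theorem slice_eq_empty {B : Finset (Fin (n + 1) → ℕ)} {d j : ℕ} (hB : B ⊆ Mon (n + 1) d)
    (hj : d < j) : slice B j = ∅ := by
  rw [eq_empty_iff_forall_notMem]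
  intro u hu
  have := le_of_mem_slice hB hu
  omega

/-- A family is the disjoint union of its slices: `|B| = Σ_j |B[j]|`. [folklore] -/
theorem card_eq_sum_card_slice {B : Finset (Fin (n + 1) → ℕ)} {d : ℕ} (hB : B ⊆ Mon (n + 1) d) :
    B.card = ∑ j ∈ range (d + 1), (slice B j).card := by
  rw [card_eq_sum_card_fiberwise (f := fun b => b (Fin.last n)) (t := range (d + 1))]
  · refine sum_congr rfl fun j _ => ?_
    rw [slice, card_image_of_injOn]
    intro b hb b' hb' h
    rw [mem_coe, mem_filter] at hb hb'
    rw [← snoc_init_self b, ← snoc_init_self b', h, hb.2, hb'.2]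
  · intro b hb
    have := mem_Mon.1 (hB hb)
    rw [Fin.sum_univ_castSucc] at this
    exact Finset.mem_coe.2 (mem_range.2 (show b (Fin.last n) < d + 1 by omega))

/-- Slices of a lex segment are lex segments (in one variable less). [folklore] -/
theorem isLexSeg_slice {L : Finset (Fin (n + 1) → ℕ)} {d : ℕ} (hL : IsLexSeg L d) {j : ℕ}
    (hj : j ≤ d) : IsLexSeg (slice L j) (d - j) := by
  refine ⟨slice_subset_Mon hL.1 j, fun u hu v hv hlt => ?_⟩
  rw [mem_slice] at hu ⊢
  refine hL.2 hu ?_ (toLex_snoc_lt_snoc_iff.2 (Or.inl hlt))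
  rw [snoc_mem_Mon, mem_Mon.1 hv]; omega

/-- Slices of a Borel set are Borel. [folklore] -/
theorem isBorel_slice {B : Finset (Fin (n + 1) → ℕ)} (hB : IsBorel B) (j : ℕ) :
    IsBorel (slice B j) := by
  intro u hu i k hik huk
  rw [mem_slice] at hu ⊢
  have h := hB hu (i := i.castSucc) (j := k.castSucc) (Fin.castSucc_lt_castSucc_iff.2 hik)
    (by simpa using huk)
  rwa [snoc_sub_e_castSucc, snoc_add_e_castSucc] at h

/-- For a Borel set, `∇ B[j+1] ⊆ B[j]` (the moves `x_n ↦ x_i`). [folklore] -/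
theorem shadow_slice_succ_subset_of_isBorel {B : Finset (Fin (n + 1) → ℕ)} (hB : IsBorel B) (j : ℕ) :
    shadow (slice B (j + 1)) ⊆ slice B j := by
  intro v hv
  obtain ⟨u, hu, i, rfl⟩ := mem_shadow.1 hv
  rw [mem_slice] at hu ⊢
  have h := hB hu (i := i.castSucc) (j := Fin.last n) (Fin.castSucc_lt_last i) (by simp)
  rwa [snoc_succ_sub_e_last, snoc_add_e_castSucc] at h

/-- Assembling a Borel set from Borel slices with nested shadows. [folklore] -/
theorem isBorel_of_slice {C : Finset (Fin (n + 1) → ℕ)} (h1 : ∀ j, IsBorel (slice C j))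
    (h2 : ∀ j, shadow (slice C (j + 1)) ⊆ slice C j) : IsBorel C := by
  intro c hc i i' hii' hci'
  rw [← snoc_init_self c] at hc hci' ⊢
  set u := Fin.init c
  set j := c (Fin.last n)
  cases i' using Fin.lastCases with
  | last =>
    obtain ⟨i, rfl⟩ := Fin.exists_castSucc_eq.2 hii'.ne
    rw [snoc_last] at hci'
    obtain ⟨j₀, hj₀⟩ : ∃ j₀, j = j₀ + 1 := ⟨j - 1, by omega⟩
    rw [hj₀] at hc ⊢
    rw [snoc_succ_sub_e_last, snoc_add_e_castSucc, ← mem_slice]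
    exact h2 j₀ (add_e_mem_shadow (mem_slice.2 hc) i)
  | cast k' =>
    obtain ⟨k, rfl⟩ := Fin.exists_castSucc_eq.2 (hii'.trans (Fin.castSucc_lt_last k')).ne
    rw [snoc_castSucc] at hci'
    rw [snoc_sub_e_castSucc, snoc_add_e_castSucc, ← mem_slice]
    exact h1 j (mem_slice.2 hc) (Fin.castSucc_lt_castSucc_iff.1 hii') hci'

/-- `μ_{≤ n}(B) = |B|`. [folklore] -/
theorem mu_last (B : Finset (Fin (n + 1) → ℕ)) : mu B (Fin.last n) = B.card := by
  rw [mu, filter_true_of_mem]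
  intro b _ j hj
  exact absurd hj (not_lt.2 (Fin.le_last j))

/-- `μ_{≤ i}(B) = μ_{≤ i}(B[0])` for `i < n`: such monomials do not involve the last variable. [folklore] -/
theorem mu_castSucc (B : Finset (Fin (n + 1) → ℕ)) (i : Fin n) :
    mu B i.castSucc = mu (slice B 0) i := by
  rw [mu, mu]
  have : (B.filter fun b => ∀ j, i.castSucc < j → b j = 0) =
      ((slice B 0).filter fun u => ∀ j, i < j → u j = 0).image fun u => snoc u 0 := by
    ext b
    simp only [mem_filter, mem_image, mem_slice]
    constructor
    · rintro ⟨hb, hz⟩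
      refine ⟨Fin.init b, ⟨?_, fun j hj => ?_⟩, ?_⟩
      · have : snoc (Fin.init b) 0 = b := by
          rw [← hz (Fin.last n) (Fin.castSucc_lt_last i)]; exact snoc_init_self b
        rwa [this]
      · have := hz j.castSucc (Fin.castSucc_lt_castSucc_iff.2 hj)
        simpa [Fin.init] using this
      · rw [← hz (Fin.last n) (Fin.castSucc_lt_last i)]; exact snoc_init_self b
    · rintro ⟨u, ⟨hu, hz⟩, rfl⟩
      refine ⟨hu, fun j hj => ?_⟩
      cases j using Fin.lastCases with
      | last => simp
      | cast j => simpa using hz j (Fin.castSucc_lt_castSucc_iff.1 hj)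
  rw [this, card_image_of_injective]
  intro u u' h
  exact (snoc_inj.1 h).1

/-- Iterating the Borel move `x_{n} ↦ x_{n-1}`: pushing the whole last exponent one variable down. [folklore] -/
theorem IsBorel.snoc_add_nsmul_mem {B : Finset (Fin (n + 1 + 1) → ℕ)} (hB : IsBorel B)
    {u : Fin (n + 1) → ℕ} {j : ℕ} (h : snoc u j ∈ B) :
    snoc (u + j • e (Fin.last n)) 0 ∈ B := by
  induction j generalizing u with
  | zero => simpa using h
  | succ j ih =>
    have h' := hB h (i := (Fin.last n).castSucc) (j := Fin.last (n + 1)) (Fin.castSucc_lt_last _)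
      (by simp)
    rw [snoc_succ_sub_e_last, snoc_add_e_castSucc] at h'
    have := ih h'
    have key : u + (j + 1) • e (Fin.last n) = u + e (Fin.last n) + j • e (Fin.last n) := by
      rw [succ_nsmul', ← add_assoc]
    rw [key]; exact this

/-! ### M–S identity (2.3): the shadow of a Borel set, counted by last variable -/

/-- For a Borel set `B` of degree-`d` monomials, `|∇B| = Σ_i μ_{≤ i}(B)`: every member of the shadow
factors uniquely as `x_i · w` with `w ∈ B` involving only `x_0, …, x_i` (Miller–Sturmfels (2.3)).
[cite: MillerSturmfels2005, (2.3)] -/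
theorem card_shadow_eq_sum_mu {B : Finset (Fin n → ℕ)} {d : ℕ} (hB : IsBorel B) (hBd : B ⊆ Mon n d) :
    (shadow B).card = ∑ i, mu B i := by
  classical
  -- fibres of the shadow by last variable
  set F : Fin n → Finset (Fin n → ℕ) :=
    fun i => (shadow B).filter fun m => 0 < m i ∧ ∀ j, i < j → m j = 0 with hF
  have hcover : shadow B = univ.biUnion F := by
    ext m
    simp only [mem_biUnion, mem_univ, true_and, hF, mem_filter]
    constructor
    · intro hm
      obtain ⟨l, hl, hlmax⟩ := exists_last_var (shadow_subset_Mon hBd hm)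
      exact ⟨l, hm, hl, hlmax⟩
    · rintro ⟨i, hm, -⟩; exact hm
  have hdisj : Set.PairwiseDisjoint (↑(univ : Finset (Fin n))) F := by
    intro i _ j _ hij
    rw [Function.onFun, disjoint_left]
    intro m hmi hmj
    rw [hF, mem_filter] at hmi hmj
    rcases lt_or_gt_of_ne hij with h | h
    · have := hmi.2.2 j h; have := hmj.2.1; omega
    · have := hmj.2.2 i h; have := hmi.2.1; omega
  rw [hcover, card_biUnion hdisj]
  refine sum_congr rfl fun i _ => ?_
  -- the fibre `F i` is the image of `{w ∈ B : vars(w) ⊆ {0..i}}` under `w ↦ w + e i`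
  have hfib : F i = (B.filter fun w => ∀ j, i < j → w j = 0).image fun w => w + e i := by
    ext m
    simp only [hF, mem_filter, mem_image]
    constructor
    · rintro ⟨hm, hmi, hmz⟩
      obtain ⟨a, ha, k, rfl⟩ := mem_shadow.1 hm
      have hki : k ≤ i := by
        by_contra h
        have := hmz k (not_le.1 h)
        simp at this
      refine ⟨a + e k - e i, ⟨?_, fun j hj => ?_⟩, sub_e_add_e hmi⟩
      · rcases hki.lt_or_eq with hki' | rfl
        · have hai : 0 < a i := by simpa [e_apply, hki'.ne'] using hmi
          rw [add_e_sub_e_comm hai hki'.ne]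
          exact hB ha hki' hai
        · rwa [add_e_sub_e]
      · have := hmz j hj
        simp only [Pi.sub_apply, this, zero_tsub]
    · rintro ⟨w, ⟨hw, hwz⟩, rfl⟩
      refine ⟨add_e_mem_shadow hw i, by simp, fun j hj => ?_⟩
      simp [hwz j hj, hj.ne']
  rw [hfib, card_image_of_injective _ (add_left_injective (e i)), mu]

/-! ### Miller–Sturmfels Lemma 2.25 -/

/-- **Miller–Sturmfels, Lemma 2.25.** If `L` is a lex segment and `B` a Borel set in `Mon n d` with
`|L| ≤ |B|`, then `μ_{≤ i}(L) ≤ μ_{≤ i}(B)` for every `i`. [cite: MillerSturmfels2005, Lemma 2.25] -/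
theorem mu_le_mu_of_isLexSeg_of_isBorel :
    ∀ (n d : ℕ) (L B : Finset (Fin n → ℕ)), IsLexSeg L d → IsBorel B → B ⊆ Mon n d →
      L.card ≤ B.card → ∀ i, mu L i ≤ mu B i := by
  intro n
  induction n with
  | zero => intro d L B _ _ _ _ i; exact i.elim0
  | succ n ih =>
    intro d L B hL hB hBd hcard i
    cases i using Fin.lastCases with
    | last => rw [mu_last, mu_last]; exact hcard
    | cast i' =>
      -- `n ≥ 1` is witnessed by `i'`
      cases n with
      | zero => exact i'.elim0
      | succ n =>
      -- Claim (M–S (2.5)): `|L[0]| ≤ |B[0]|`.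
      have hclaim : (slice L 0).card ≤ (slice B 0).card := by
        -- compress every slice of `B` to a lex segment of the same size
        have hex : ∀ j, ∃ Cj : Finset (Fin (n + 1) → ℕ),
            IsLexSeg Cj (d - j) ∧ Cj.card = (slice B j).card := fun j =>
          exists_isLexSeg_card_eq (d - j) _ (card_le_card (slice_subset_Mon hBd j))
        choose Cf hCf using hex
        have hCfMon : ∀ j, Cf j ⊆ Mon (n + 1) (d - j) := fun j => (hCf j).1.1
        have hCfempty : ∀ j, d < j → Cf j = ∅ := fun j hj =>
          card_eq_zero.1 (by rw [(hCf j).2, slice_eq_empty hBd hj, card_empty])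
        -- induction hypothesis on every slice
        have hmu : ∀ j i, mu (Cf j) i ≤ mu (slice B j) i := fun j =>
          ih (d - j) (Cf j) (slice B j) (hCf j).1 (isBorel_slice hB j) (slice_subset_Mon hBd j)
            (hCf j).2.le
        -- nested shadows: `∇ C[j+1] ⊆ C[j]`
        have hnest : ∀ j, shadow (Cf (j + 1)) ⊆ Cf j := by
          intro j
          by_cases hj : j + 1 ≤ d
          · have hdeg : d - (j + 1) + 1 = d - j := by omega
            have hseg : IsLexSeg (shadow (Cf (j + 1))) (d - j) := hdeg ▸ isLexSeg_shadow (hCf (j + 1)).1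
            refine hseg.subset_of_card_le (hCf j).1 ?_
            calc (shadow (Cf (j + 1))).card = ∑ i, mu (Cf (j + 1)) i :=
                  card_shadow_eq_sum_mu (hCf (j + 1)).1.isBorel (hCfMon (j + 1))
              _ ≤ ∑ i, mu (slice B (j + 1)) i := sum_le_sum fun i _ => hmu (j + 1) i
              _ = (shadow (slice B (j + 1))).card :=
                  (card_shadow_eq_sum_mu (isBorel_slice hB (j + 1)) (slice_subset_Mon hBd (j + 1))).symm
              _ ≤ (slice B j).card := card_le_card (shadow_slice_succ_subset_of_isBorel hB j)
              _ = (Cf j).card := (hCf j).2.symm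
          · rw [hCfempty (j + 1) (by omega)]
            simp [shadow]
        -- the assembled set `C`
        set C : Finset (Fin (n + 1 + 1) → ℕ) :=
          (Mon (n + 1 + 1) d).filter fun c => Fin.init c ∈ Cf (c (Fin.last (n + 1))) with hC
        have hCMon : C ⊆ Mon (n + 1 + 1) d := filter_subset _ _
        have hsliceC : ∀ j, slice C j = Cf j := by
          intro j
          ext u
          rw [mem_slice, hC, mem_filter, init_snoc, snoc_last, snoc_mem_Mon]
          constructor
          · exact fun h => h.2
          · intro hu
            refine ⟨?_, hu⟩
            have h1 := mem_Mon.1 (hCfMon j hu)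
            have h2 : j ≤ d := by
              by_contra h; rw [hCfempty j (not_le.1 h)] at hu; exact absurd hu (notMem_empty u)
            omega
        have hCBorel : IsBorel C :=
          isBorel_of_slice (fun j => (hsliceC j).symm ▸ (hCf j).1.isBorel)
            (fun j => by rw [hsliceC, hsliceC]; exact hnest j)
        have hcardC : C.card = B.card := by
          rw [card_eq_sum_card_slice hCMon, card_eq_sum_card_slice hBd]
          exact sum_congr rfl fun j _ => by rw [hsliceC, (hCf j).2]
        -- Suppose the claim fails; then `C[0] ⊊ L[0]`; pick `u ∈ L[0] \ C[0]`.
        by_contra hlt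
        rw [not_le, ← (hCf 0).2, ← hsliceC 0] at hlt
        have hL0 : IsLexSeg (slice L 0) d := by simpa using isLexSeg_slice hL (Nat.zero_le d)
        have hC0 : IsLexSeg (slice C 0) d := by rw [hsliceC]; simpa using (hCf 0).1
        obtain ⟨u, huL, huC⟩ := exists_of_ssubset
          (ssubset_of_subset_of_ne (hC0.subset_of_card_le hL0 hlt.le)
            (fun h => by rw [h] at hlt; exact lt_irrefl _ hlt))
        -- every `c ∈ C` lies strictly above `snoc u 0`
        have habove : ∀ c ∈ C, toLex (snoc u 0) < toLex c := by
          intro c hc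
          have hσ : snoc (Fin.init c + c (Fin.last (n + 1)) • e (Fin.last n)) 0 ∈ C :=
            hCBorel.snoc_add_nsmul_mem (by rw [snoc_init_self]; exact hc)
          rw [← mem_slice] at hσ
          set c' := Fin.init c with hc'
          set j := c (Fin.last (n + 1)) with hj
          -- `u < σ(c)` in `Mon (n+1) d`
          have hne : u ≠ c' + j • e (Fin.last n) := fun h => huC (h ▸ hσ)
          have hlt' : toLex u < toLex (c' + j • e (Fin.last n)) := by
            rcases lt_trichotomy (toLex u) (toLex (c' + j • e (Fin.last n))) with h | h | h
            · exact h
            · exact absurd (toLex.injective h) hne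
            · exact absurd (hC0.2 hσ (hL0.1 huL) h) huC
          -- hence `u < c'`
          have hdegu : ∑ k, u k = d := mem_Mon.1 (hL0.1 huL)
          have hdegc : ∑ k, c' k + j = d := by
            have := mem_Mon.1 (hCMon hc)
            rwa [← snoc_init_self c, sum_snoc] at this
          have hlt'' : toLex u < toLex c' := by
            obtain ⟨p, hp, hup⟩ := lex_lt_iff.1 hlt'
            cases p using Fin.lastCases with
            | cast p =>
              refine lex_lt_iff.2 ⟨p.castSucc, fun q hq => ?_, ?_⟩
              · have := hp q hq
                simpa [e_apply, (hq.trans (Fin.castSucc_lt_last p)).ne] using this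
              · simpa [e_apply, (Fin.castSucc_lt_last p).ne] using hup
            | last =>
              exfalso
              have heq : ∀ q : Fin n, u q.castSucc = c' q.castSucc := fun q => by
                simpa [e_apply, (Fin.castSucc_lt_last q).ne] using hp q.castSucc (Fin.castSucc_lt_last q)
              rw [Fin.sum_univ_castSucc] at hdegu hdegc
              simp only [heq] at hdegu
              simp at hup
              omega
          rw [← snoc_init_self c]
          exact toLex_snoc_lt_snoc_iff.2 (Or.inl hlt'')
        -- so `C ⊊ L`, contradicting `|L| ≤ |B| = |C|`
        have hsnocu : snoc u 0 ∈ L := mem_slice.1 huL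
        have hCL : C ⊆ L := fun c hc => hL.2 hsnocu (hCMon hc) (habove c hc)
        have hnot : snoc u 0 ∉ C := fun h => huC (mem_slice.2 h)
        have : C.card < L.card := card_lt_card ⟨hCL, fun h => hnot (h hsnocu)⟩
        omega
      -- conclude by induction on the `0`-slices
      rw [mu_castSucc, mu_castSucc]
      exact ih d (slice L 0) (slice B 0) (by simpa using isLexSeg_slice hL (Nat.zero_le d))
        (isBorel_slice hB 0) (by simpa using slice_subset_Mon hBd 0) hclaim i'

/-- **Macaulay's theorem for Borel sets** (Miller–Sturmfels, proof of Prop. 2.21 / Thm. 2.22): among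
Borel sets of degree-`d` monomials of at least a given size, the lex segment has the smallest upper
shadow. [cite: MillerSturmfels2005, Thm. 2.22] -/
theorem card_shadow_le_of_isLexSeg_of_isBorel {d : ℕ} {L B : Finset (Fin n → ℕ)} (hL : IsLexSeg L d)
    (hB : IsBorel B) (hBd : B ⊆ Mon n d) (h : L.card ≤ B.card) :
    (shadow L).card ≤ (shadow B).card := by
  rw [card_shadow_eq_sum_mu hL.isBorel hL.1, card_shadow_eq_sum_mu hB hBd]
  exact sum_le_sum fun i _ => mu_le_mu_of_isLexSeg_of_isBorel n d L B hL hB hBd h i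

end Literature.RingTheory.MvPolynomial.Macaulay
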